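import Literature.NumberTheory.EllipticCurves.FineSelmerTorsionPointFieldMuRoad
import Literature.NumberTheory.EllipticCurves.ModPIrreducibleZpLayers
import HarnessLib

/-!
# Coates–Sujatha's Conjecture A from the classical `μ`-invariant of the fixed field of ANY small subgroup
# fixing a torsion point: the TAME-FREE torsion-structure-field `μ`-road (proved)

`Proofs`-style file (theorems only: no definition, no named fact, no `sorry`) in topic
`NumberTheory/EllipticCurves`, written by the literature seat `bsd-potss-conjA-anchor` g20 (cell `bsd-potss`;
serves the asides stmt-BirchSwinnertonDyer-19386 / 19413; closes nothing; (A) / BSD is proved for no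
particular curve here).  Namespaces: `Literature.NumberTheory.EllipticCurves.FineSelmerStabilizerDescent`
(§1–§2, descent lemmas) and `…EllipticCurves.CoatesSujatha2005` (§3–§4, the criteria).

THE THEOREM (`CoatesSujatha2005.conjA_of_classicalMuVanishes_fixedField`).  `K` a number field, `E = W/K`
elliptic, `p` an ODD prime with `E[p]` IRREDUCIBLE (no tameness, no image hypothesis), `P ∈ E[p] ∖ 0`, and
`Θ ≤ Γ_K` any subgroup with `Gal(K̄/K(E[p])) ≤ Θ ≤ Stab(P)` whose image in `Gal(K(E[p])/K)` has order prime to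
`p`; `F = K̄^Θ` (a number field between `K(P)` and `K(E[p])`).  IF the classical Iwasawa `μ`-invariant of the
cyclotomic `ℤ_p`-extension of `F` vanishes (`IwasawaTheory.ClassicalMuVanishes`, growth form, for every —
equivalently one — cyclotomic `ℤ_p`-extension of `F`), THEN statement (A) of Coates–Sujatha holds for `E` at `p`:
the Pontryagin dual of `Sel₀(E/K_∞)[p^∞]` is finitely generated over `ℤ_p` (`∃ γ D, Module.Finite ℤ_[p] D.X`).
Bounded-rank form `fineSelmerDual_moduleFinite_of_classGroupPRank_fixedField_le`; numeric doors at `F` (§4):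
Iwasawa 1956 (`p ∤ h(F)`, one prime above `p`), Fukuda 1994 Thm. 1 (1)/(2) from ANY layer `n ≥ n₀` of total
ramification (`TotallyRamifiedFrom κ_F n₀`).

This is the seat's Door L8 (`conjA_of_classicalMuVanishes_stabilizerField`, sibling file
`FineSelmerTorsionPointFieldMuRoad`: `Θ = Stab(P)`, TAME `p ∤ #Gal(K(E[p])/K)`) with BOTH uses of tameness
removed: (i) irreducibility of `E[p]` under `Gal(K̄/K_n)` now comes from the sibling
`ModPIrreducibleLayer.irreducible_layerSubgroup_of_odd` (`p` odd suffices); (ii) the averaging operator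
`∑_{h ∈ H} h̃` only needs `p ∤ #H` for the image `H` of `Θ` — not of `Stab(P)` — in `Gal(K(E[p])/K)`.  For a curve
with `GL₂(𝔽_p)`-image (e.g. the surjective-mod-`3` rows of the cell's item 19386) `p ∣ #Stab(P) = p(p-1)`, so Door
L8 is void, but `Θ = Stab(P) ∩ Stab(⟨Q⟩)` (`Q ∉ ⟨P⟩`) has image `{diag(1,d)}` of order `p - 1`: the sibling
`FineSelmerPointLineFieldMuRoad` draws that corollary («`E[p]` irreducible + `μ_p(K(P,⟨Q⟩)_cyc) = 0 ⟹` (A)», no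
image hypothesis at all; `[K(P,⟨Q⟩) : ℚ] = 24` on the `GL₂(𝔽₃)` rows).

Proof.  As in the sibling: by the isotypic bounded-multiplicity criterion
(`fineSelmerDual_moduleFinite_of_card_equivariantHom_le`) it suffices to bound the `Gal(K̄/K_n)`-equivariant
additive maps `μ : Cl(L_n) → E[p]`, `L_n = K(E[p])·K_n`; restriction along `i : Cl(F_n) → Cl(L_n)`,
`F_n = L_n^{H_n} = F·K_n` (`H_n` the image of `Θ ∩ Gal(K̄/K_n)`), is injective on them (§1: `μ ∘ i ∘ N = (∑_{h∈H_n} h̃) ∘ μ`,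
`(∑ h̃)(P) = #H_n · P ≠ 0` as `#H_n ∣ #res_{K(E[p])}(Θ)` is prime to `p` (§2), and the image of an equivariant map
spans a `Gal(K̄/K_n)`-stable subgroup, which is `0` or everything by `irreducible_layerSubgroup_of_odd`); then
`#Hom(Cl(F_n), E[p]) ≤ #E[p]^{rank_p Cl(F_n)}` and `F_n ≅` a layer of the shifted cyclotomic `ℤ_p`-extension of `F`,
whose `p`-ranks are bounded under `μ = 0` (Washington Prop. 13.23, tree
`exists_forall_classGroupPRank_le_of_classicalMuVanishes`).

References: [CoatesSujatha2005] J. Coates, R. Sujatha, *Fine Selmer groups of elliptic curves over `p`-adic Lie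
extensions*, Math. Ann. 331 (2005) 809–839, §3 Lemma 3.8, Thm. 3.4; [DeoRaySujatha2023] S. V. Deo, A. Ray,
R. Sujatha, *On the μ equals zero conjecture for fine Selmer groups in Iwasawa theory*, Pure Appl. Math. Q. 19
(2023), §3 Thm. 3.8/3.9, §5 Lemma 5.1; [Lim2017FineSelmer] M. F. Lim, *Notes on the fine Selmer groups*, Asian J.
Math. 21 (2017), §3; [NeukirchANT1999] Ch. III §1 Prop. (1.6) (iv), Ch. IV §1; [Washington1997] §13.1, §13.3;
[Fukuda1994] T. Fukuda, *Remarks on `ℤ_p`-extensions of number fields*, Proc. Japan Acad. 70 (1994), Thm. 1;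
[Greenberg2001IwasawaPastPresent] R. Greenberg, *Iwasawa theory — past and present*, Adv. Stud. Pure Math. 30 (2001), Prop. 2.1.
-/

set_option autoImplicit false

noncomputable section

open scoped Classical Pointwise NumberField
open NumberField IsDedekindDomain Field IntermediateField

namespace Literature.NumberTheory.EllipticCurves.FineSelmerStabilizerDescent

open Literature.NumberTheory.GaloisRepresentations Literature.NumberTheory.NumberFields
  Literature.NumberTheory.EllipticCurves Literature.NumberTheory.EllipticCurves.ZpExtension
  Literature.NumberTheory.IwasawaTheory.EquivariantUnramifiedHomsZpTowerFinite

/-! ## §1 Equivariant additive maps on `Cl(L)` restrict injectively to `Cl(L^{H})`, `H` fixing `P`, `p ∤ #H` -/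

variable {K : Type} [Field K] [NumberField K]

/-- An element killed by two coprime natural numbers is zero. [folklore] -/
private theorem eq_zero_of_nsmul_eq_zero_of_coprime' {M : Type*} [AddMonoid M] {a b : ℕ}
    (hab : a.Coprime b) {x : M} (ha : a • x = 0) (hb : b • x = 0) : x = 0 := by
  have hord : addOrderOf x ∣ 1 := by
    rw [← hab]
    exact Nat.dvd_gcd (addOrderOf_dvd_of_nsmul_eq_zero ha) (addOrderOf_dvd_of_nsmul_eq_zero hb)
  exact AddMonoid.addOrderOf_eq_one_iff.mp (Nat.dvd_one.mp hord)

/-- **An equivariant additive map `Cl(𝓞_L) → V` vanishing on the classes extended from `L^{H}` is zero, for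
`H` the image of ANY subgroup `Θ ≤ Stab(P)` (intersected with the equivariance group) with `p ∤ #H`.**  Setting:
`L ⊆ K̄` finite Galois over the number field `K`; `Γ₀ ≤ Γ_K`; `V` a `p`-torsion `Γ_K`-module whose only
`Γ₀`-stable subgroups are `⊥` and `⊤`; `P ∈ V ∖ 0`; `Θ ≤ Stab_{Γ_K}(P)`; `H ≤ Gal(L/K)` the image of `Θ ∩ Γ₀`, of
order prime to `p`.  If `ν : Cl(𝓞_L) → V` is additive and `Γ₀`-equivariant and `ν ∘ i_{L/L^{H}} = 0`, then `ν = 0`: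
`ν(i(N c)) = ∑_{h ∈ H} h̃ • ν(c)` (Neukirch III (1.6)(iv) on classes), the averaging operator `T = ∑_{h∈H} h̃` has
`T(P) = #H · P ≠ 0` (every `h̃ ∈ Θ` fixes `P`), and `{v : T(δ v) = 0 ∀ δ ∈ Γ₀}` is a `Γ₀`-stable subgroup containing
`ν(Cl_L)` and not `P`.  The case `Θ = Stab(P)` is the sibling's
`equivariantHom_eq_zero_of_comp_classGroupExtend_fixedField_eq_zero`.
[cite: NeukirchANT1999, Ch. III §1 Prop. (1.6) (iv)]
[cite: DeoRaySujatha2023, §3 Thm. 3.8 (c2) and Lemma 5.1 (descent of Hom_G(Cl(L), E[p]) to a subfield)] -/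
theorem equivariantHom_eq_zero_of_comp_classGroupExtend_fixedField_eq_zero_of_le_stabilizer
    (L : IntermediateField K (AlgebraicClosure K)) [FiniteDimensional K L] [IsGalois K L] [NumberField L]
    (Γ₀ : Subgroup (absoluteGaloisGroup K))
    {V : Type*} [AddCommGroup V] [DistribMulAction (absoluteGaloisGroup K) V]
    {p : ℕ} [Fact p.Prime] (hpV : ∀ v : V, p • v = 0)
    (hirr : ∀ U : AddSubgroup V, (∀ γ ∈ Γ₀, ∀ v ∈ U, γ • v ∈ U) → U = ⊥ ∨ U = ⊤)
    (P : V) (hP0 : P ≠ 0) (Θ : Subgroup (absoluteGaloisGroup K))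
    (hΘP : Θ ≤ MulAction.stabilizer (absoluteGaloisGroup K) P)
    (hH : ¬ p ∣ Nat.card ↥((Θ ⊓ Γ₀).map (absRestrictNormalHom L)))
    (ν : Additive (ClassGroup (𝓞 L)) →+ V)
    (hν : ∀ γ ∈ Γ₀, ∀ c : ClassGroup (𝓞 L),
      ν (Additive.ofMul (ClassGroup.mulEquiv (AmbiguousClass.intAut (absRestrictNormalHom L γ)) c)) =
        γ • ν (Additive.ofMul c))
    (hνi : ∀ d : ClassGroup (𝓞 ↥(fixedField ((Θ ⊓ Γ₀).map (absRestrictNormalHom L)))),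
      ν (Additive.ofMul (classGroupExtend ↥(fixedField ((Θ ⊓ Γ₀).map (absRestrictNormalHom L))) L d)) = 0) :
    ν = 0 := by
  have hp : p.Prime := Fact.out
  set S : Subgroup (L ≃ₐ[K] L) := (Θ ⊓ Γ₀).map (absRestrictNormalHom L) with hSdef
  -- lifts of the elements of `S = H` to `Θ ∩ Γ₀`
  have hlift : ∀ s : S, ∃ g : absoluteGaloisGroup K, g ∈ Θ ⊓ Γ₀ ∧ absRestrictNormalHom L g = s := fun s =>
    Subgroup.mem_map.mp s.2
  choose lift hlift_mem hlift_res using hlift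
  have hliftP : ∀ s : S, lift s • P = P := fun s =>
    MulAction.mem_stabilizer_iff.mp (hΘP (Subgroup.mem_inf.mp (hlift_mem s)).1)
  have hliftΓ : ∀ s : S, lift s ∈ Γ₀ := fun s => (Subgroup.mem_inf.mp (hlift_mem s)).2
  -- the averaging operator `T = ∑_{h ∈ H} h̃`
  set T : V →+ V := ∑ s : S, DistribSMul.toAddMonoidHom V (lift s) with hTdef
  have hT : ∀ v : V, T v = ∑ s : S, lift s • v := by
    intro v
    rw [hTdef, AddMonoidHom.finsetSum_apply]
    rfl
  -- `ν(i(N c)) = T(ν c)`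
  have hkey : ∀ c : ClassGroup (𝓞 L),
      ν (Additive.ofMul (classGroupExtend ↥(fixedField S) L (classGroupNorm ↥(fixedField S) L c))) =
        T (ν (Additive.ofMul c)) := by
    intro c
    rw [NormRelation.classGroupExtend_classGroupNorm_fixedField_eq_prod K L S c, ofMul_prod, map_sum, hT]
    refine Finset.sum_congr rfl fun s _ => ?_
    rw [← hν (lift s) (hliftΓ s) c, hlift_res s]
  have hTν : ∀ c : ClassGroup (𝓞 L), T (ν (Additive.ofMul c)) = 0 := fun c => by
    rw [← hkey]; exact hνi _
  -- `T P = #H • P ≠ 0`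
  have hTP : T P = (Fintype.card S) • P := by
    rw [hT]
    simp_rw [hliftP]
    rw [Finset.sum_const, Finset.card_univ]
  have hTP0 : T P ≠ 0 := by
    intro h0
    apply hP0
    have hcop : (Fintype.card S).Coprime p := by
      rw [← Nat.card_eq_fintype_card]
      exact Nat.coprime_comm.mp ((Nat.Prime.coprime_iff_not_dvd hp).mpr hH)
    exact eq_zero_of_nsmul_eq_zero_of_coprime' hcop (hTP ▸ h0) (hpV P)
  -- the `Γ₀`-stable subgroup `U = {v : T(δ v) = 0 ∀ δ ∈ Γ₀}`
  set U : AddSubgroup V := ⨅ δ : Γ₀, (T.comp (DistribSMul.toAddMonoidHom V (δ : absoluteGaloisGroup K))).ker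
    with hUdef
  have hmemU : ∀ v : V, v ∈ U ↔ ∀ δ : Γ₀, T ((δ : absoluteGaloisGroup K) • v) = 0 := by
    intro v
    rw [hUdef, AddSubgroup.mem_iInf]
    refine forall_congr' fun δ => ?_
    rw [AddMonoidHom.mem_ker]
    rfl
  have hUstab : ∀ γ ∈ Γ₀, ∀ v ∈ U, γ • v ∈ U := by
    intro γ hγ v hv
    rw [hmemU] at hv ⊢
    intro δ
    rw [← mul_smul]
    exact hv ⟨δ * γ, mul_mem δ.2 hγ⟩
  have hPU : P ∉ U := by
    intro hP
    rw [hmemU] at hP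
    have h1 := hP ⟨1, one_mem _⟩
    rw [Subgroup.coe_mk, one_smul] at h1
    exact hTP0 h1
  have hUbot : U = ⊥ := by
    rcases hirr U hUstab with h | h
    · exact h
    · exact absurd (h ▸ AddSubgroup.mem_top P) hPU
  have hνU : ∀ c : ClassGroup (𝓞 L), ν (Additive.ofMul c) ∈ U := by
    intro c
    rw [hmemU]
    intro δ
    rw [← hν δ δ.2 c]
    exact hTν _
  refine AddMonoidHom.ext fun a => ?_
  have h := hνU (Additive.toMul a)
  rw [ofMul_toMul, hUbot, AddSubgroup.mem_bot] at h
  rw [h, AddMonoidHom.zero_apply]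

/-- **Counting form.**  In the setting of the previous theorem, restriction along `i_{L/L^{H}}` is injective on
the `Γ₀`-equivariant additive maps `Cl(𝓞_L) → V`, so their number is at most `#Hom(Cl(𝓞_{L^{H}}), V)`.
[cite: DeoRaySujatha2023, §3 Thm. 3.8 (c2) and Lemma 5.1] [cite: NeukirchANT1999, Ch. III §1 Prop. (1.6) (iv)] -/
theorem natCard_equivariantHom_le_natCard_hom_fixedField_of_le_stabilizer
    (L : IntermediateField K (AlgebraicClosure K)) [FiniteDimensional K L] [IsGalois K L]
    (Γ₀ : Subgroup (absoluteGaloisGroup K))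
    {V : Type*} [AddCommGroup V] [Finite V] [DistribMulAction (absoluteGaloisGroup K) V]
    {p : ℕ} [Fact p.Prime] (hpV : ∀ v : V, p • v = 0)
    (hirr : ∀ U : AddSubgroup V, (∀ γ ∈ Γ₀, ∀ v ∈ U, γ • v ∈ U) → U = ⊥ ∨ U = ⊤)
    (P : V) (hP0 : P ≠ 0) (Θ : Subgroup (absoluteGaloisGroup K))
    (hΘP : Θ ≤ MulAction.stabilizer (absoluteGaloisGroup K) P)
    (hH : ¬ p ∣ Nat.card ↥((Θ ⊓ Γ₀).map (absRestrictNormalHom L))) :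
    Nat.card {μ : Additive (ClassGroup (𝓞 L)) →+ V //
        ∀ γ ∈ Γ₀, ∀ c : ClassGroup (𝓞 L),
          μ (Additive.ofMul (ClassGroup.mulEquiv (AmbiguousClass.intAut (absRestrictNormalHom L γ)) c)) =
            γ • μ (Additive.ofMul c)} ≤
      Nat.card (Additive (ClassGroup (𝓞 ↥(fixedField ((Θ ⊓ Γ₀).map (absRestrictNormalHom L))))) →+ V) := by
  haveI : NumberField L := NumberField.of_module_finite K L
  set S : Subgroup (L ≃ₐ[K] L) := (Θ ⊓ Γ₀).map (absRestrictNormalHom L) with hSdef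
  haveI : Finite (Additive (ClassGroup (𝓞 ↥(fixedField S))) →+ V) :=
    Finite.of_injective (fun ν => (ν : Additive (ClassGroup (𝓞 ↥(fixedField S))) → V))
      (fun ν ν' h => DFunLike.coe_injective h)
  let Φ : {μ : Additive (ClassGroup (𝓞 L)) →+ V //
        ∀ γ ∈ Γ₀, ∀ c : ClassGroup (𝓞 L),
          μ (Additive.ofMul (ClassGroup.mulEquiv (AmbiguousClass.intAut (absRestrictNormalHom L γ)) c)) =
            γ • μ (Additive.ofMul c)} →
      (Additive (ClassGroup (𝓞 ↥(fixedField S))) →+ V) :=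
    fun μ => μ.1.comp (MonoidHom.toAdditive (classGroupExtend ↥(fixedField S) L))
  have hΦ : ∀ μ d, Φ μ (Additive.ofMul d) =
      μ.1 (Additive.ofMul (classGroupExtend ↥(fixedField S) L d)) := fun _ _ => rfl
  refine Nat.card_le_card_of_injective Φ fun μ μ' h => ?_
  apply Subtype.ext
  rw [← sub_eq_zero]
  refine equivariantHom_eq_zero_of_comp_classGroupExtend_fixedField_eq_zero_of_le_stabilizer L Γ₀ hpV hirr P hP0
    Θ hΘP hH (μ.1 - μ'.1) (fun γ hγ c => ?_) (fun d => ?_)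
  · rw [AddMonoidHom.sub_apply, AddMonoidHom.sub_apply, μ.2 γ hγ c, μ'.2 γ hγ c, smul_sub]
  · rw [AddMonoidHom.sub_apply, ← hΦ μ d, ← hΦ μ' d, h, sub_self]

/-! ## §2 `#res_L(S) ∣ #res_{K(E[p])}(Θ)` for `S ≤ Θ` -/

section Tower

variable {p : ℕ} [Fact p.Prime] (W : WeierstrassCurve K) [W.IsElliptic]

omit [Fact p.Prime] in
/-- **`#res_L(S) ∣ #res_{K(E[p])}(Θ)`** for `S ≤ Θ`, `S ≤ Γ₀` and `L ⊆ K̄` normal over `K` with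
`Gal(K̄/L) = Gal(K̄/K(E[p])) ∩ Γ₀`: the restrictions of `S` to `L` and to `K(E[p])` have the same kernel
`S ∩ Gal(K̄/K(E[p]))`, so `res_L(S) ≅ res_{K(E[p])}(S) ≤ res_{K(E[p])}(Θ)` (Lagrange).  Sharpens the sibling's
`natCard_map_absRestrictNormalHom_dvd_card_aut_divisionField` (`∣ #Gal(K(E[p])/K)`).
[cite: SilvermanAEC2009, VIII.§1 (Gal(K(E[m])/K) ↪ Aut(E[m]))] [cite: NeukirchANT1999, Ch. IV §1] -/
theorem natCard_map_absRestrictNormalHom_dvd_natCard_map_divisionField [NeZero p]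
    (L : IntermediateField K (AlgebraicClosure K)) [Normal K L] (Γ₀ S Θ : Subgroup (absoluteGaloisGroup K))
    (hS : S ≤ Γ₀) (hSΘ : S ≤ Θ)
    (hL : ∀ σ : absoluteGaloisGroup K, absRestrictNormalHom L σ = 1 ↔
      σ ∈ fixingSubgroupOfModule K ↥(W.geomTorsion (p : ℤ)) ⊓ Γ₀) :
    Nat.card ↥(S.map (absRestrictNormalHom L)) ∣
      Nat.card ↥(Θ.map (absRestrictNormalHom (W.divisionField p))) := by
  set r₁ : ↥S →* (L ≃ₐ[K] L) := (absRestrictNormalHom L).comp S.subtype with hr₁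
  set r₂ : ↥S →* ((W.divisionField p) ≃ₐ[K] (W.divisionField p)) :=
    (absRestrictNormalHom (W.divisionField p)).comp S.subtype with hr₂
  have hrange : S.map (absRestrictNormalHom L) = r₁.range := by
    rw [hr₁, ← MonoidHom.map_range, Subgroup.range_subtype]
  have hrange₂ : r₂.range = S.map (absRestrictNormalHom (W.divisionField p)) := by
    rw [hr₂, ← MonoidHom.map_range, Subgroup.range_subtype]
  have hker : r₁.ker = r₂.ker := by
    ext σ
    rw [MonoidHom.mem_ker, MonoidHom.mem_ker]
    change absRestrictNormalHom L (σ : absoluteGaloisGroup K) = 1 ↔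
      absRestrictNormalHom (W.divisionField p) (σ : absoluteGaloisGroup K) = 1
    rw [hL, W.absRestrictNormalHom_divisionField_eq_one_iff p, Subgroup.mem_inf,
      W.mem_fixingSubgroupOfModule_geomTorsion_iff]
    exact ⟨fun h => h.1, fun h => ⟨h, hS σ.2⟩⟩
  calc Nat.card ↥(S.map (absRestrictNormalHom L)) = Nat.card ↥r₁.range := by rw [hrange]
    _ = Nat.card (↥S ⧸ r₁.ker) := Nat.card_congr (QuotientGroup.quotientKerEquivRange r₁).symm.toEquiv
    _ = Nat.card (↥S ⧸ r₂.ker) := by rw [hker]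
    _ = Nat.card ↥r₂.range := Nat.card_congr (QuotientGroup.quotientKerEquivRange r₂).toEquiv
    _ ∣ Nat.card ↥(Θ.map (absRestrictNormalHom (W.divisionField p))) :=
        Subgroup.card_dvd_of_le (hrange₂ ▸ Subgroup.map_mono hSΘ)

end Tower

end Literature.NumberTheory.EllipticCurves.FineSelmerStabilizerDescent

/-! ## §3 Statement (A) from the class groups along the cyclotomic tower of `F = K̄^Θ` -/

namespace Literature.NumberTheory.EllipticCurves.CoatesSujatha2005

open WeierstrassCurve Literature.NumberTheory.IwasawaTheory Literature.NumberTheory.GaloisRepresentations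
  Literature.NumberTheory.NumberFields Literature.NumberTheory.EllipticCurves
  Literature.NumberTheory.EllipticCurves.GreenbergSelmer Literature.NumberTheory.EllipticCurves.ZpExtension
  Literature.NumberTheory.IwasawaTheory.EquivariantUnramifiedHomsZpTowerFinite
  Literature.NumberTheory.EllipticCurves.FineSelmerStabilizerDescent
  Literature.NumberTheory.EllipticCurves.ModPIrreducibleLayer

variable {K : Type} [Field K] [NumberField K] (W : WeierstrassCurve K) [W.IsElliptic] {p : ℕ} [Fact p.Prime]

/-- **Statement (A) from bounded `[Cl(F_n) : Cl(F_n)^p]` along `F_n = (K(E[p])·K_n)^{H_n}`** (general form,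
`p` odd, NO tameness).  `E = W` elliptic over a number field `K`, `p` odd, `E[p]` irreducible, `P ∈ E[p] ∖ 0`,
`Θ ≤ Γ_K` with `Gal(K̄/K(E[p])) ≤ Θ ≤ Stab(P)` and `p ∤ #res_{K(E[p])}(Θ)`, `κ` the cyclotomic `ℤ_p`-extension of
`K`, `L_n = K̄^{N ∩ κ⁻¹(pⁿℤ_p)}` (`N = Gal(K̄/K(E[p]))`), `H_n ≤ Gal(L_n/K)` the image of `Θ ∩ κ⁻¹(pⁿℤ_p)`,
`F_n = L_n^{H_n}` (`= K̄^Θ·K_n`).  If the index of the `p`-th powers in `Cl(𝓞_{F_n})` is `≤ C` for every `n`, then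
the dual fine Selmer group of `E` over `K_∞` is finitely generated over `ℤ_p`.
[cite: CoatesSujatha2005, §3 Lemma 3.8 and Thm. 3.4] [cite: DeoRaySujatha2023, §3 Thm. 3.9 (b) and §5 Lemma 5.1]
[cite: Lim2017FineSelmer, §3] -/
theorem fineSelmerDual_moduleFinite_of_index_fixedField_layer_le (hp : p ≠ 2)
    (hirr : W.HasIrreducibleModPGaloisRep p) (Θ : Subgroup (absoluteGaloisGroup K))
    (P : ↥(W.geomTorsion (p : ℤ))) (hP0 : P ≠ 0)
    (hΘP : Θ ≤ MulAction.stabilizer (absoluteGaloisGroup K) P)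
    (hH : haveI : NeZero p := ⟨(Fact.out : p.Prime).ne_zero⟩
      ¬ p ∣ Nat.card ↥(Θ.map (absRestrictNormalHom (W.divisionField p))))
    (κ : ZpExtension K p) (hκ : κ.IsCyclotomic) (C : ℕ)
    (hC : ∀ n : ℕ,
      haveI := W.fixingSubgroupOfModule_geomTorsion_normal p
      haveI : IsGalois K (fixedField (fixingSubgroupOfModule K ↥(W.geomTorsion (p : ℤ)) ⊓ κ.layerSubgroup n) :
          IntermediateField K (AlgebraicClosure K)) :=
        isGalois_fixedField_inf_layerSubgroup κ (fixingSubgroupOfModule K ↥(W.geomTorsion (p : ℤ)))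
          (W.isOpen_fixingSubgroupOfModule_geomTorsion p) n
      (powMonoidHom p : ClassGroup (𝓞 ↥(fixedField
          ((Θ ⊓ κ.layerSubgroup n).map
            (absRestrictNormalHom (fixedField
              (fixingSubgroupOfModule K ↥(W.geomTorsion (p : ℤ)) ⊓ κ.layerSubgroup n) :
                IntermediateField K (AlgebraicClosure K)))) :
          IntermediateField K ↥(fixedField (fixingSubgroupOfModule K ↥(W.geomTorsion (p : ℤ)) ⊓ κ.layerSubgroup n) :
            IntermediateField K (AlgebraicClosure K)))) →* _).range.index ≤ C) :
    ∃ (γ : absoluteGaloisGroup K) (D : W.FineSelmerDualData κ γ),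
      Module.Finite ℤ_[p] (RestrictScalars ℤ_[p] (IwasawaAlgebra p) D.X) := by
  have hpr : p.Prime := Fact.out
  haveI : NeZero p := ⟨hpr.ne_zero⟩
  haveI : Finite ↥(W.geomTorsion (p : ℤ)) := W.finite_geomTorsion_nat hpr.ne_zero
  haveI : ContinuousSMul (absoluteGaloisGroup K) ↥(W.geomTorsion (p : ℤ)) :=
    WeierstrassCurve.continuousSMul_geomTorsion W (WeierstrassCurve.isOpen_stabilizer_point_holds W) (p : ℤ)
  set N : Subgroup (absoluteGaloisGroup K) := fixingSubgroupOfModule K ↥(W.geomTorsion (p : ℤ)) with hNdef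
  haveI : N.Normal := W.fixingSubgroupOfModule_geomTorsion_normal p
  have hN : IsOpen (N : Set (absoluteGaloisGroup K)) := W.isOpen_fixingSubgroupOfModule_geomTorsion p
  have hpM : ∀ m : ↥(W.geomTorsion (p : ℤ)), p • m = 0 := fun m =>
    Subtype.ext (by
      rw [AddSubmonoidClass.coe_nsmul, ZeroMemClass.coe_zero]
      exact AddSubgroup.torsionBy.nsmul_iff.mp m.2)
  have hVpos : 0 < Nat.card ↥(W.geomTorsion (p : ℤ)) := Nat.card_pos
  refine fineSelmerDual_moduleFinite_of_card_equivariantHom_le W hp κ hκ (Nat.card ↥(W.geomTorsion (p : ℤ)) ^ C)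
    fun n => ?_
  set Ln : IntermediateField K (AlgebraicClosure K) := fixedField (N ⊓ κ.layerSubgroup n) with hLn
  have hopen : IsOpen ((N ⊓ κ.layerSubgroup n : Subgroup (absoluteGaloisGroup K)) : Set (absoluteGaloisGroup K)) :=
    hN.inter (κ.isOpen_layerSubgroup n)
  haveI hgal : IsGalois K Ln := isGalois_fixedField_inf_layerSubgroup κ N hN n
  haveI : FiniteDimensional K Ln := finiteDimensional_fixedField_of_isOpen _ hopen
  haveI : NumberField Ln := NumberField.of_module_finite K Ln
  have hL : ∀ σ : absoluteGaloisGroup K, absRestrictNormalHom Ln σ = 1 ↔ σ ∈ N ⊓ κ.layerSubgroup n := by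
    intro σ
    rw [absRestrictNormalHom_eq_one_iff]
    exact SetLike.ext_iff.mp (fixingSubgroup_fixedField_of_isOpen _ hopen) σ
  -- irreducibility under `Gal(K̄/K_n)`: `p` odd suffices (sibling `ModPIrreducibleZpLayers`)
  have hirr' : ∀ U : AddSubgroup ↥(W.geomTorsion (p : ℤ)),
      (∀ γ ∈ κ.layerSubgroup n, ∀ v ∈ U, γ • v ∈ U) → U = ⊥ ∨ U = ⊤ :=
    irreducible_layerSubgroup_of_odd W hp κ hirr n
  set S : Subgroup (Ln ≃ₐ[K] Ln) := (Θ ⊓ κ.layerSubgroup n).map (absRestrictNormalHom Ln) with hS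
  have hH' : ¬ p ∣ Nat.card ↥S := fun h =>
    hH (h.trans (natCard_map_absRestrictNormalHom_dvd_natCard_map_divisionField W Ln (κ.layerSubgroup n)
      (Θ ⊓ κ.layerSubgroup n) Θ inf_le_right inf_le_left hL))
  calc Nat.card {μ : Additive (ClassGroup (𝓞 Ln)) →+ ↥(W.geomTorsion (p : ℤ)) //
          ∀ γ ∈ κ.layerSubgroup n, ∀ c,
            μ (Additive.ofMul (ClassGroup.mulEquiv (AmbiguousClass.intAut (absRestrictNormalHom Ln γ)) c)) =
              γ • μ (Additive.ofMul c)}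
        ≤ Nat.card (Additive (ClassGroup (𝓞 ↥(fixedField S))) →+ ↥(W.geomTorsion (p : ℤ))) :=
      natCard_equivariantHom_le_natCard_hom_fixedField_of_le_stabilizer Ln (κ.layerSubgroup n) hpM hirr' P hP0 Θ
        hΘP hH'
    _ ≤ Nat.card ↥(W.geomTorsion (p : ℤ)) ^
          (powMonoidHom p : ClassGroup (𝓞 ↥(fixedField S)) →* ClassGroup (𝓞 ↥(fixedField S))).range.index :=
      natCard_addMonoidHom_le_pow_index hpM
    _ ≤ Nat.card ↥(W.geomTorsion (p : ℤ)) ^ C := Nat.pow_le_pow_right hVpos (hC n)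

/-- `[Cl : Cl^q]` is invariant under isomorphism of (class) groups. [folklore] -/
private theorem index_range_pow_eq_of_mulEquiv' {G H : Type*} [CommGroup G] [CommGroup H] (e : G ≃* H) (q : ℕ) :
    (powMonoidHom q : H →* H).range.index = (powMonoidHom q : G →* G).range.index := by
  have hmap : (powMonoidHom q : G →* G).range.map e.toMonoidHom = (powMonoidHom q : H →* H).range := by
    ext h
    constructor
    · rintro ⟨x, ⟨y, rfl⟩, rfl⟩
      exact ⟨e y, by rw [powMonoidHom_apply, powMonoidHom_apply, MulEquiv.coe_toMonoidHom, map_pow]⟩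
    · rintro ⟨y, rfl⟩
      refine ⟨e.symm y ^ q, ⟨e.symm y, rfl⟩, ?_⟩
      rw [powMonoidHom_apply, MulEquiv.coe_toMonoidHom, map_pow, MulEquiv.apply_symm_apply]
  rw [← hmap, Subgroup.index_map_of_bijective e.bijective]

/-- **Coates–Sujatha's statement (A) from BOUNDED `p`-RANKS along the cyclotomic tower of `F = K̄^Θ`** (proved;
`p` odd, NO tameness).  `E = W` elliptic over a number field `K`, `p` odd, `E[p]` irreducible, `P ∈ E[p] ∖ 0`,
`Gal(K̄/K(E[p])) ≤ Θ ≤ Stab(P)` with `p ∤ #res_{K(E[p])}(Θ)`, `F = K̄^Θ`.  If some cyclotomic `ℤ_p`-extension `κ_F`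
of `F` has `rank_p Cl(F_m) ≤ B` for every layer `m`, then for the cyclotomic `ℤ_p`-extension `κ` of `K` the dual
fine Selmer group of `E` over `K_∞` is finitely generated over `ℤ_p`.  (Layers: `F·K_n = K̄^{Θ ∩ κ⁻¹(pⁿℤ_p)}` is a
layer of the shifted base change of `κ` to `F`, tree `ZpExtension.exists_zpExtension_shift`.)
[cite: CoatesSujatha2005, §3 Lemma 3.8 and Thm. 3.4] [cite: DeoRaySujatha2023, §3 Thm. 3.9 (b) and §5 Lemma 5.1]
[cite: Washington1997, §13.1] -/
theorem fineSelmerDual_moduleFinite_of_classGroupPRank_fixedField_le (hp : p ≠ 2)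
    (hirr : W.HasIrreducibleModPGaloisRep p) (Θ : Subgroup (absoluteGaloisGroup K))
    (hNΘ : fixingSubgroupOfModule K ↥(W.geomTorsion (p : ℤ)) ≤ Θ)
    (P : ↥(W.geomTorsion (p : ℤ))) (hP0 : P ≠ 0)
    (hΘP : Θ ≤ MulAction.stabilizer (absoluteGaloisGroup K) P)
    (hH : haveI : NeZero p := ⟨(Fact.out : p.Prime).ne_zero⟩
      ¬ p ∣ Nat.card ↥(Θ.map (absRestrictNormalHom (W.divisionField p))))
    (κ : ZpExtension K p) (hκ : κ.IsCyclotomic) (B : ℕ)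
    (hB : ∃ κF : ZpExtension ↥(fixedField Θ : IntermediateField K (AlgebraicClosure K)) p,
      κF.IsCyclotomic ∧ ∀ m, classGroupPRank κF m ≤ B) :
    ∃ (γ : absoluteGaloisGroup K) (D : W.FineSelmerDualData κ γ),
      Module.Finite ℤ_[p] (RestrictScalars ℤ_[p] (IwasawaAlgebra p) D.X) := by
  have hpr : p.Prime := Fact.out
  haveI : NeZero p := ⟨hpr.ne_zero⟩
  haveI : Finite ↥(W.geomTorsion (p : ℤ)) := W.finite_geomTorsion_nat hpr.ne_zero
  set N : Subgroup (absoluteGaloisGroup K) := fixingSubgroupOfModule K ↥(W.geomTorsion (p : ℤ)) with hNdef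
  haveI : N.Normal := W.fixingSubgroupOfModule_geomTorsion_normal p
  have hN : IsOpen (N : Set (absoluteGaloisGroup K)) := W.isOpen_fixingSubgroupOfModule_geomTorsion p
  have hΘopen : IsOpen (Θ : Set (absoluteGaloisGroup K)) := Subgroup.isOpen_mono hNΘ hN
  set KP : IntermediateField K (AlgebraicClosure K) := fixedField Θ with hKP
  haveI : FiniteDimensional K KP := finiteDimensional_fixedField_of_isOpen Θ hΘopen
  haveI : NumberField KP := NumberField.of_module_finite K KP
  obtain ⟨κP, hκP, hBκ⟩ := hB
  -- the shifted base change `κ'` of `κ` to `F` is cyclotomic, so has the same `p`-ranks as `κ_F`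
  obtain ⟨a, κ', hs⟩ := exists_zpExtension_shift κ ↥KP
  have hκ' : κ'.IsCyclotomic := isCyclotomic_of_shift κ ↥KP κ' hs hκ
  refine fineSelmerDual_moduleFinite_of_index_fixedField_layer_le W hp hirr Θ P hP0 hΘP hH κ hκ (p ^ B) fun n => ?_
  set Ln : IntermediateField K (AlgebraicClosure K) := fixedField (N ⊓ κ.layerSubgroup n) with hLn
  have hopen : IsOpen ((N ⊓ κ.layerSubgroup n : Subgroup (absoluteGaloisGroup K)) : Set (absoluteGaloisGroup K)) :=
    hN.inter (κ.isOpen_layerSubgroup n)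
  haveI hgal : IsGalois K Ln := isGalois_fixedField_inf_layerSubgroup κ N hN n
  haveI : FiniteDimensional K Ln := finiteDimensional_fixedField_of_isOpen _ hopen
  set S : Subgroup (Ln ≃ₐ[K] Ln) := (Θ ⊓ κ.layerSubgroup n).map (absRestrictNormalHom Ln) with hS
  show (powMonoidHom p : ClassGroup (𝓞 ↥(fixedField S : IntermediateField K Ln)) →* _).range.index ≤ p ^ B
  -- `F_n = Ln^S ≅ K̄^{Θ ∩ κ⁻¹(pⁿℤ_p)} = F ⊔ K_n ≅ κ'.layer m`
  obtain ⟨m, hnm⟩ := exists_layerSubgroup_eq_comap_of_shift κ ↥KP κ' hs n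
  obtain ⟨e⟩ := nonempty_ringEquiv_layer_fieldRange_sup_layer_of_layerSubgroup_eq κ ↥KP κ' hnm KP.val
  have hfield : (KP.val.fieldRange ⊔ κ.layer n) =
      (fixedField (Θ ⊓ κ.layerSubgroup n) : IntermediateField K (AlgebraicClosure K)) := by
    rw [IntermediateField.fieldRange_val, hKP, fixedField_inf_layerSubgroup_eq_fixedField_sup_layer κ Θ hΘopen n]
  have hlift : IntermediateField.lift (fixedField S : IntermediateField K Ln) =
      (fixedField (Θ ⊓ κ.layerSubgroup n) : IntermediateField K (AlgebraicClosure K)) :=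
    lift_fixedField_map_absRestrictNormalHom_eq Ln (Θ ⊓ κ.layerSubgroup n) (N ⊓ κ.layerSubgroup n)
      (inf_le_inf_right _ hNΘ) hLn.symm
  let e' : ↥(κ'.layer m) ≃+* ↥(fixedField S : IntermediateField K Ln) :=
    e.trans ((IntermediateField.equivOfEq hfield).toRingEquiv.trans
      ((IntermediateField.liftAlgEquiv (fixedField S : IntermediateField K Ln)).trans
        (IntermediateField.equivOfEq hlift)).toRingEquiv.symm)
  rw [index_range_pow_eq_of_mulEquiv' (ClassGroup.mulEquiv (RingOfIntegers.mapRingEquiv e')) p,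
    index_range_pow_layer_eq κ' m, classGroupPRank_eq_of_isCyclotomic κ' κP hκ' hκP m]
  exact Nat.pow_le_pow_right hpr.pos (hBκ m)

/-- **THE TAME-FREE TORSION-STRUCTURE-FIELD `μ`-ROAD (PROVED): `μ_p((K̄^Θ)_cyc) = 0 ⟹` statement (A) for `E` at
`p`.**  `E = W` elliptic over a number field `K`, `p` an ODD prime with `E[p]` IRREDUCIBLE, `P ∈ E[p] ∖ 0`, `Θ` a
subgroup of `Γ_K` with `Gal(K̄/K(E[p])) ≤ Θ ≤ Stab(P)` whose image in `Gal(K(E[p])/K)` has order prime to `p`,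
`F = K̄^Θ`.  If every (equivalently one) cyclotomic `ℤ_p`-extension of `F` has vanishing classical `μ`-invariant
(`IwasawaTheory.ClassicalMuVanishes`, growth form), then for the cyclotomic `ℤ_p`-extension `κ` of `K` the Pontryagin
dual of `Sel₀(E/K_∞)[p^∞]` is finitely generated over `ℤ_p` — Conjecture A of Coates–Sujatha for `E` at `p` over
`K_∞`.  No tameness, no hypothesis at the primes above `p` or at the bad primes; `Θ = Stab(P)` with `p ∤ #G` is the
sibling's Door L8, `Θ = Gal(K̄/K(E[p]))` is Coates–Sujatha's Thm. 3.4 (tree `thm34_…_holds`).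
[cite: CoatesSujatha2005, §3 Thm. 3.4 and Lemma 3.8] [cite: DeoRaySujatha2023, §3 Thm. 3.9 (b) and §5 Lemma 5.1]
[cite: Washington1997, §13.3 Prop. 13.23 (μ = 0 ⟹ bounded p-ranks)] -/
theorem conjA_of_classicalMuVanishes_fixedField (hp : p ≠ 2) (hirr : W.HasIrreducibleModPGaloisRep p)
    (Θ : Subgroup (absoluteGaloisGroup K)) (hNΘ : fixingSubgroupOfModule K ↥(W.geomTorsion (p : ℤ)) ≤ Θ)
    (P : ↥(W.geomTorsion (p : ℤ))) (hP0 : P ≠ 0)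
    (hΘP : Θ ≤ MulAction.stabilizer (absoluteGaloisGroup K) P)
    (hH : haveI : NeZero p := ⟨(Fact.out : p.Prime).ne_zero⟩
      ¬ p ∣ Nat.card ↥(Θ.map (absRestrictNormalHom (W.divisionField p))))
    (hμ : ∀ κF : ZpExtension ↥(fixedField Θ : IntermediateField K (AlgebraicClosure K)) p,
      κF.IsCyclotomic → ClassicalMuVanishes κF)
    (κ : ZpExtension K p) (hκ : κ.IsCyclotomic) :
    ∃ (γ : absoluteGaloisGroup K) (D : W.FineSelmerDualData κ γ),
      Module.Finite ℤ_[p] (RestrictScalars ℤ_[p] (IwasawaAlgebra p) D.X) := by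
  have hpr : p.Prime := Fact.out
  haveI : NeZero p := ⟨hpr.ne_zero⟩
  have hN : IsOpen ((fixingSubgroupOfModule K ↥(W.geomTorsion (p : ℤ)) : Subgroup (absoluteGaloisGroup K)) :
      Set (absoluteGaloisGroup K)) := W.isOpen_fixingSubgroupOfModule_geomTorsion p
  have hΘopen : IsOpen (Θ : Set (absoluteGaloisGroup K)) := Subgroup.isOpen_mono hNΘ hN
  set KP : IntermediateField K (AlgebraicClosure K) := fixedField Θ with hKP
  haveI : FiniteDimensional K KP := finiteDimensional_fixedField_of_isOpen Θ hΘopen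
  haveI : NumberField KP := NumberField.of_module_finite K KP
  -- a cyclotomic `ℤ_p`-extension of `F` exists (the shifted base change of `κ`); `μ = 0` bounds its `p`-ranks
  obtain ⟨a, κ', hs⟩ := exists_zpExtension_shift κ ↥KP
  have hκ' : κ'.IsCyclotomic := isCyclotomic_of_shift κ ↥KP κ' hs hκ
  obtain ⟨B, hB⟩ := exists_forall_classGroupPRank_le_of_classicalMuVanishes κ' (hμ κ' hκ')
  exact fineSelmerDual_moduleFinite_of_classGroupPRank_fixedField_le W hp hirr Θ hNΘ P hP0 hΘP hH κ hκ B
    ⟨κ', hκ', hB⟩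

/-! ## §4 Numeric doors at `F = K̄^Θ` (Iwasawa 1956; Fukuda 1994 Thm. 1 (1)/(2) from any layer `n₀`) -/

/-- **Door L9.1 (Iwasawa 1956 at `F = K̄^Θ`): `p ∤ h(F)` and ONE prime of `F` above `p` ⟹ statement (A).**  Setting
as in `conjA_of_classicalMuVanishes_fixedField` (`p` odd, `E[p]` irreducible, `Gal(K̄/K(E[p])) ≤ Θ ≤ Stab(P)`,
`p ∤ #res_{K(E[p])}(Θ)`): if `p` does not divide the class number of `F` and exactly one prime of `F` lies above `p`,
then `p ∤ h(F_m)` for every layer of every `ℤ_p`-extension of `F` (Iwasawa, tree `iwasawa1956_…_holds`; no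
ramification hypothesis), so the `p`-ranks vanish and (A) holds for `E` at `p`.
[cite: Greenberg2001IwasawaPastPresent, Prop. 2.1 p. 339] [cite: CoatesSujatha2005, §3 Thm. 3.4]
[cite: DeoRaySujatha2023, §3 Thm. 3.9 (b)] -/
theorem conjA_of_not_dvd_classNumber_fixedField_of_unique_prime (hp : p ≠ 2)
    (hirr : W.HasIrreducibleModPGaloisRep p)
    (Θ : Subgroup (absoluteGaloisGroup K)) (hNΘ : fixingSubgroupOfModule K ↥(W.geomTorsion (p : ℤ)) ≤ Θ)
    (P : ↥(W.geomTorsion (p : ℤ))) (hP0 : P ≠ 0)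
    (hΘP : Θ ≤ MulAction.stabilizer (absoluteGaloisGroup K) P)
    (hH : haveI : NeZero p := ⟨(Fact.out : p.Prime).ne_zero⟩
      ¬ p ∣ Nat.card ↥(Θ.map (absRestrictNormalHom (W.divisionField p))))
    (hh : ∀ [NumberField ↥(fixedField Θ : IntermediateField K (AlgebraicClosure K))],
      ¬ p ∣ NumberField.classNumber ↥(fixedField Θ : IntermediateField K (AlgebraicClosure K)))
    (hv : ∃! v : HeightOneSpectrum (𝓞 ↥(fixedField Θ : IntermediateField K (AlgebraicClosure K))),
      ((p : ℕ) : 𝓞 ↥(fixedField Θ : IntermediateField K (AlgebraicClosure K))) ∈ v.asIdeal)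
    (κ : ZpExtension K p) (hκ : κ.IsCyclotomic) :
    ∃ (γ : absoluteGaloisGroup K) (D : W.FineSelmerDualData κ γ),
      Module.Finite ℤ_[p] (RestrictScalars ℤ_[p] (IwasawaAlgebra p) D.X) := by
  have hpr : p.Prime := Fact.out
  haveI : NeZero p := ⟨hpr.ne_zero⟩
  have hN : IsOpen ((fixingSubgroupOfModule K ↥(W.geomTorsion (p : ℤ)) : Subgroup (absoluteGaloisGroup K)) :
      Set (absoluteGaloisGroup K)) := W.isOpen_fixingSubgroupOfModule_geomTorsion p
  have hΘopen : IsOpen (Θ : Set (absoluteGaloisGroup K)) := Subgroup.isOpen_mono hNΘ hN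
  set KP : IntermediateField K (AlgebraicClosure K) := fixedField Θ with hKP
  haveI : FiniteDimensional K KP := finiteDimensional_fixedField_of_isOpen Θ hΘopen
  haveI : NumberField KP := NumberField.of_module_finite K KP
  obtain ⟨a, κ', hs⟩ := exists_zpExtension_shift κ ↥KP
  have hκ' : κ'.IsCyclotomic := isCyclotomic_of_shift κ ↥KP κ' hs hκ
  refine fineSelmerDual_moduleFinite_of_classGroupPRank_fixedField_le W hp hirr Θ hNΘ P hP0 hΘP hH κ hκ 0
    ⟨κ', hκ', fun m => ?_⟩
  have h0 := iwasawa1956_classNumberPExp_eq_zero_of_not_dvd_classNumber_of_unique_prime_holds ↥KP p hh hv κ' m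
  have := classGroupPRank_le_classNumberPExp κ' m
  omega

/-- **Door L9.2 (Fukuda 1994 Thm. 1 (1) at `F = K̄^Θ`): `ord_p h(F_{n+1}) = ord_p h(F_n)` for ONE `n ≥ n₀` ⟹
statement (A)**, provided every cyclotomic `ℤ_p`-extension of `F` is totally ramified at the primes above `p` from
layer `n₀` (`TotallyRamifiedFrom κ_F n₀`; for `p ∤ [K(E[p]) : K]`, `n₀ = 0` is automatic, in general not).
Setting as in Door L9.1.  The class numbers are then constant from `n` on, so `μ_p(F_cyc) = 0` (tree
`classicalMuVanishes_of_classNumberPExp_succ_eq'`). [cite: Fukuda1994, Thm. 1 (1), p. 264]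
[cite: CoatesSujatha2005, §3 Thm. 3.4] [cite: DeoRaySujatha2023, §5 Lemma 5.1] -/
theorem conjA_of_classNumberPExp_fixedField_succ_eq (hp : p ≠ 2) (hirr : W.HasIrreducibleModPGaloisRep p)
    (Θ : Subgroup (absoluteGaloisGroup K)) (hNΘ : fixingSubgroupOfModule K ↥(W.geomTorsion (p : ℤ)) ≤ Θ)
    (P : ↥(W.geomTorsion (p : ℤ))) (hP0 : P ≠ 0)
    (hΘP : Θ ≤ MulAction.stabilizer (absoluteGaloisGroup K) P)
    (hH : haveI : NeZero p := ⟨(Fact.out : p.Prime).ne_zero⟩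
      ¬ p ∣ Nat.card ↥(Θ.map (absRestrictNormalHom (W.divisionField p))))
    (n₀ n : ℕ) (hn : n₀ ≤ n)
    (hram : ∀ κF : ZpExtension ↥(fixedField Θ : IntermediateField K (AlgebraicClosure K)) p,
      κF.IsCyclotomic → TotallyRamifiedFrom κF n₀)
    (hord : ∀ κF : ZpExtension ↥(fixedField Θ : IntermediateField K (AlgebraicClosure K)) p,
      κF.IsCyclotomic → classNumberPExp κF (n + 1) = classNumberPExp κF n)
    (κ : ZpExtension K p) (hκ : κ.IsCyclotomic) :
    ∃ (γ : absoluteGaloisGroup K) (D : W.FineSelmerDualData κ γ),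
      Module.Finite ℤ_[p] (RestrictScalars ℤ_[p] (IwasawaAlgebra p) D.X) := by
  have hpr : p.Prime := Fact.out
  haveI : NeZero p := ⟨hpr.ne_zero⟩
  have hN : IsOpen ((fixingSubgroupOfModule K ↥(W.geomTorsion (p : ℤ)) : Subgroup (absoluteGaloisGroup K)) :
      Set (absoluteGaloisGroup K)) := W.isOpen_fixingSubgroupOfModule_geomTorsion p
  have hΘopen : IsOpen (Θ : Set (absoluteGaloisGroup K)) := Subgroup.isOpen_mono hNΘ hN
  haveI : FiniteDimensional K ↥(fixedField Θ : IntermediateField K (AlgebraicClosure K)) :=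
    finiteDimensional_fixedField_of_isOpen Θ hΘopen
  haveI : NumberField ↥(fixedField Θ : IntermediateField K (AlgebraicClosure K)) := NumberField.of_module_finite K _
  exact conjA_of_classicalMuVanishes_fixedField W hp hirr Θ hNΘ P hP0 hΘP hH
    (fun κF hκF => classicalMuVanishes_of_classNumberPExp_succ_eq' κF (hram κF hκF) hn (hord κF hκF)) κ hκ

/-- **Door L9.3 (Fukuda 1994 Thm. 1 (2) at `F = K̄^Θ`): `rank_p Cl(F_{n+1}) = rank_p Cl(F_n)` for ONE `n ≥ n₀` ⟹
statement (A)**, provided every cyclotomic `ℤ_p`-extension of `F` has `TotallyRamifiedFrom κ_F n₀`.  Setting as in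
Door L9.1.  The `p`-ranks are then constant from `n` on, so `μ_p(F_cyc) = 0` (tree
`classicalMuVanishes_of_classGroupPRank_succ_eq'`).  For `K = ℚ`, `p = 3`, a `GL₂(𝔽₃)`-image curve and
`Θ = Stab(P) ∩ Stab(⟨Q⟩)` this is ONE comparison of the `3`-ranks of the class groups of the degree-`24` field
`ℚ(P, x(Q))` and of its first cyclotomic layer (degree `72`). [cite: Fukuda1994, Thm. 1 (2), p. 264]
[cite: CoatesSujatha2005, §3 Thm. 3.4] [cite: DeoRaySujatha2023, §5 Lemma 5.1] -/
theorem conjA_of_classGroupPRank_fixedField_succ_eq (hp : p ≠ 2) (hirr : W.HasIrreducibleModPGaloisRep p)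
    (Θ : Subgroup (absoluteGaloisGroup K)) (hNΘ : fixingSubgroupOfModule K ↥(W.geomTorsion (p : ℤ)) ≤ Θ)
    (P : ↥(W.geomTorsion (p : ℤ))) (hP0 : P ≠ 0)
    (hΘP : Θ ≤ MulAction.stabilizer (absoluteGaloisGroup K) P)
    (hH : haveI : NeZero p := ⟨(Fact.out : p.Prime).ne_zero⟩
      ¬ p ∣ Nat.card ↥(Θ.map (absRestrictNormalHom (W.divisionField p))))
    (n₀ n : ℕ) (hn : n₀ ≤ n)
    (hram : ∀ κF : ZpExtension ↥(fixedField Θ : IntermediateField K (AlgebraicClosure K)) p,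
      κF.IsCyclotomic → TotallyRamifiedFrom κF n₀)
    (hrk : ∀ κF : ZpExtension ↥(fixedField Θ : IntermediateField K (AlgebraicClosure K)) p,
      κF.IsCyclotomic → classGroupPRank κF (n + 1) = classGroupPRank κF n)
    (κ : ZpExtension K p) (hκ : κ.IsCyclotomic) :
    ∃ (γ : absoluteGaloisGroup K) (D : W.FineSelmerDualData κ γ),
      Module.Finite ℤ_[p] (RestrictScalars ℤ_[p] (IwasawaAlgebra p) D.X) := by
  have hpr : p.Prime := Fact.out
  haveI : NeZero p := ⟨hpr.ne_zero⟩
  have hN : IsOpen ((fixingSubgroupOfModule K ↥(W.geomTorsion (p : ℤ)) : Subgroup (absoluteGaloisGroup K)) :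
      Set (absoluteGaloisGroup K)) := W.isOpen_fixingSubgroupOfModule_geomTorsion p
  have hΘopen : IsOpen (Θ : Set (absoluteGaloisGroup K)) := Subgroup.isOpen_mono hNΘ hN
  haveI : FiniteDimensional K ↥(fixedField Θ : IntermediateField K (AlgebraicClosure K)) :=
    finiteDimensional_fixedField_of_isOpen Θ hΘopen
  haveI : NumberField ↥(fixedField Θ : IntermediateField K (AlgebraicClosure K)) := NumberField.of_module_finite K _
  exact conjA_of_classicalMuVanishes_fixedField W hp hirr Θ hNΘ P hP0 hΘP hH
    (fun κF hκF => classicalMuVanishes_of_classGroupPRank_succ_eq' κF (hram κF hκF) hn (hrk κF hκF)) κ hκ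

end Literature.NumberTheory.EllipticCurves.CoatesSujatha2005

end
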